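import Literature.MathematicalPhysics.QuantumFieldTheory.Balaban1983to89.B9Cor36GDirBondCutSetExtent
import Literature.MathematicalPhysics.QuantumFieldTheory.Balaban1983to89.B9Cor36GDirBondDatumOfReg335Cube

/-!
# `Balaban1983to89.B9Cor36GDirBondDatumInscribed` — [Balaban1985BackgroundPropagators] Cor. 3.6 p. 408 l. 1–14 («Ω₀(□) ⊂ □⁵ … the number O(1) in the condition (3.35) can be
# taken as equal to 12, thus the cube □⁵ is contained in one of the cubes for which this condition holds») with [Balaban1984PropagatorsII] (2.2) p. 224: THE LEVEL HALF OF THE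
# (3.35) DATUM INSCRIPTION UNDER THE PRINT-LANGUAGE SEPARATION HYPOTHESIS `SepY i deepRY` ((2.2) at the constant `(2R + 8L + 2)·L`), AND D3 = ✓D1 ∘ (T1) ∘ (T2): the heads'
# (3.35) datum rows `hDatBu` (`DatumBUY`) AND `hDat36u` (`Datum36UY`) DISCHARGED FROM THE REGIME OF RECORD `regYP335` ON THE RANGE `SepY` (all directions of `□` mirrored)
# (seat dag-n06-c g37, FILES (T2)+(T3) of LOCATED-42 §2)

statement-level skeleton of published theorems with citation tags; proofs where landed; nothing here is a claim about the Yang–Mills mass gap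

CITATION HEADER (lean-in-tree rule).  B9 = T. Bałaban, *Propagators for lattice gauge theories in a background field*, Commun. Math. Phys. **99** (1985) 389–434
[Balaban1985BackgroundPropagators] (held `paper:balaban1985-cmp99-background-propagators`; journal page = PDF page + 388): (3.35) p. 396 («for cubes □ of the following class:
□ ⊂ Bʲ(Λ_j) ∪ B^{j+1}(Λ_{j+1}), □ ∩ Bʲ(Λ_j) ≠ ∅, □ is a union of several big blocks … its size … is O(1)MLʲη»), Cor. 3.6 p. 408 l. 1–14, p. 408 l. 25–35 («We need two different
scales … M = KR₀M₀»), p. 409 l. 1–5; [4] = T. Bałaban, *Propagators and renormalization transformations for lattice gauge theories. II*, Commun. Math. Phys. **96** (1984)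
223–250 [Balaban1984PropagatorsII], (2.1)–(2.2) p. 224 («(Lʲη)⁻¹dist(Ω_jᶜ, Ω_{j+1}) > RM»).  Rows B9.Cor3.6 × B9.Eq3.35 × B6.Eq2.2 (cells only; no row head changes).

WHY THIS FILE (cell `pub-ymgap`, node N06 [B9]; LOCATED-42).  LOCATED-42 (this seat, 2026-09-01): with r05's single-scale collars the Dirichlet domain `Ω₀(□) ⊇ C₁(□)` of a cover
cube `□ = (j, β)` reaches `(R + 2L)·S_j` beyond `β`, while the member's (2.2) only keeps territories of level `≤ j − 2` farther than `R·S_j∕(L−1)` from `β`'s level-`j` witness —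
so at SHALLOW cubes `Ω₀(□)` meets three or more levels, NO print-class cube (levels `{j′, j′+1}`) contains it, and the heads' rows `hDatBu ∕ hDat36u` (one gauge straightening
`U` at the cube's top scale on all of `Ω₀(□)`) are unsatisfiable as typed there.  What IS true is typed here: under the separation hypothesis `SepY i deepRY` — (2.2) at the
constant `deepRY = (2R + 8L + 2)·L` in place of `R`, the print-language «R sufficiently large» read against r05's collars — every site of (T1)'s aligned cube
`torusCube (cornerYCut i □) ((4R+16L+1)·S_j)` has member level `j−1`, `j` or `j+1`, and not both `j−1` and `j+1` occur; so the cube is a class triple of index `j′ = j` or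
`j′ = j − 1` (same set, `S_{j−1}`-aligned, `L` times more blocks), meeting `j′` — ✓D1's `(hlev, hmeet, hc₀)`; with (T1)'s `hbox` this gives `DatumBUY` and `Datum36UY` from
`regYP335` at the constant `2·(nDatY·M·α₀)·L⁴`, `nDatY = (4R+16L+1)·L`, `Λ = L²`.  The heads can thus discharge `hDatBu ∕ hDat36u` ON THE RANGE `SepY x.toKIdx (deepRY x.toKIdx)`
(repair (ρ2) of LOCATED-42 §3; (ρ1) = a collar parameter independent of `R` would turn the range into a plain `R`-threshold — director-ym to rule).

WHAT IS PROVED (3 bookkeeping `def`s with bodies — `SepY` (a hypothesis SHAPE on the member, (2.2) at a constant; NOT asserted), `deepRY`, `nDatY`; theorems; 0 sorry;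
0 `def … : Prop` facts; 0 new named facts; standard axioms): §1 `SepY`, `sepY_self` (the member's own (2.2) is `SepY i R`), `sepY_mono`, `sepY_of_const_lev` (one-level members are in the range at every constant), `deepRY`; §2 `torusSupNorm_sub_wit_le`,
`torusSupNorm_sub_le_of_mem`, `deep_arith`, ★`levV1_window_of_sepY` (levels in `[j−1, j+1]`), ★`not_both_of_sepY`, ★★`exists_inscription_of_sepY` (the class triple
`(j′, n′)`, `j′ ∈ {j−1, j}`, `nD ≤ n′ ≤ nD·L`, with ✓D1's four geometric hypotheses); §3 `nDatY`, `numerics_mono`, ★★★`datumBUY_of_regYP335_of_sepY`; §4 (site twin)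
`datum36UY_of_reg335Cube`, `datum36UY_of_reg335BodyP`, ★★★`datum36UY_of_regYP335_of_sepY`.

HONEST SCOPE ∕ NOT CLAIMED.  `SepY i deepRY` is a HYPOTHESIS on the member (false for members with minimal-width shells; true e.g. for wide-shell members and `TDomains.top`);
nothing is claimed at shallow cubes, where LOCATED-42 §1(v) shows the rows fail.  Crude constants.  No estimate of [B9]; the knit numerics and the regime smallness are the
caller's (displayed).  Nothing on `d = 4`, the continuum, reflection positivity or the mass gap; NOT a node discharge; count-neutral; no row head changes.  NEW file; nothing
landed is modified.  `--supports stmt-QuantumFields-27239`.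

RELATED IN THE TREE, NOT DUPLICATED (searched 2026-09-01: `rg 'SepY|deepRY|nDatY|_of_sepY|datum36UY_of_reg335'` over `Literature/` + `Summits/` = ∅): ✓`B9Cor36GDirBondCutSetExtent`
((T1): `cornerYCut`, `bondCutSetY_subset_torusCube`, `wit_mem_torusCube`, `circAbs_le_of_mem_torusCube_cornerYCut` — USED), ✓`B9Cor36GDirBondDatumOfReg335Cube` ((D1):
`datumBUY_of_reg335BodyP`, `unitExtY` — USED), ✓`B9Cor36GpDirMemberBlocksAtRecordY` (`Datum36UY`), ✓`B9BackgroundsKLevelV1P` (`cubeClassP`, `reg335CubeP_of_reg335P` — USED),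
✓`B6MultiLevelTorusOperator.TDomains.sepT` (the member's (2.2) at `R`).
-/

noncomputable section

namespace Literature.MathematicalPhysics.QuantumFieldTheory.Balaban1983to89.B9Cor36GDirBondDatumInscribed

open B4Reflection242 (boxDom mem_boxDom blk)
open B4TorusKernel.MultiPeriod (torusSupNorm circAbs circAbs_nonneg circAbs_add_mul circAbs_le_abs)
open B6MultiLevelBoxOperator (N0 bigSide bigSide_succ one_le_bigSide)
open B6MultiLevelTorusOperator (one_le_N0)
open B6Cover236MultiLevelBlocks (cubes wit lev_wit blk_wit)
open B6GlobalChartV1 (PV toBox boxEquiv)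
open B6KLevelCensusIndexV1 (KIdx kGeo)
open B9CubeSequence408 (sI hf ctrC sI_pos two_mul_hf_add_one sI_succ abs_sub_ctrC_le_of_blk_eq circAbs_sub_comm torusSupNorm_le_of_forall one_le_cube_level cube_level_le)
open B9CubeSequence408Mirrors (mirC)
open B9CubeLettersOpsL0 (oddMh)
open B9CubeDirInverseBondCMemberRowsAtRecordY (bondCutSetY)
open B9BackgroundsKLevelV1 (torusCube levV1)
open B9BackgroundsKLevelV1P (bg9KP)
open B9BackgroundsKLevelV1R (regYP335)
open B9PinMembersKLevelV1 (MemberY)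
open B9Cor36GDirKnitRowsAtMemberY (DatumBUY)
open B9Cor36GDirBondDatumOfReg335Cube (datumBUY_of_reg335BodyP unitExtY unitExtY_mem_unitaryUnits gaugeY_unitExtY_eq gaugeY_eq_gaugeTr kGeo_L_eq)
open B9Cor36GpDirMemberBlocksAtRecordY (Datum36UY)
open B9CubeDirInverseBondCMemberRowsAtRecordY (dirDomY_subset_bondCutSetY)
open B9BackgroundsKLevelV1 (shiftsV1)
open B9BackgroundsKLevelV1P (alignedCube_mem_cubeClassP reg335CubeP_of_reg335P)
open B9Eq335RegularityClasses (Reg335Cube)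
open B9Eq39Adjoint (fluct covD)
open B9Eq3117Current (gaugeTr)
open B6MultiLevelBoxOperator (bigSide)
open B7Prop2Explicit (C0 c2' unitaryUnits)
open B7Prop3Flat (c3)
open Node00 (GaugeY)
open B9Cor36GDirBondCutSetExtent (nHalfY cornerYCut bigSide_dvd_cornerYCut_val bondCutSetY_subset_torusCube wit_mem_torusCube levV1_wit circAbs_le_of_mem_torusCube_cornerYCut
  circAbs_sub_le_add)
open B6Prop22KLevelTorusCensus.KTIdx (circAbs_le_torusSupNorm)
open Node00 (SiteY CfgY toKT)
open scoped Matrix Matrix.Norms.L2Operator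

variable {d ℓ : ℕ} {hd : 1 ≤ d + 1} {hL : Odd (ℓ + 1) ∧ 1 < ℓ + 1} {b₀ b₁ : ℝ} {N : ℕ}

/-! ## §1  (2.2) at a larger constant: the separation hypothesis `SepY i R′` and the deepness constant `deepRY = (nHalfY + 2)·L` -/

section Sep

variable (i : KIdx d ℓ hd hL b₀ b₁)

/-- **(2.2) WITH THE CONSTANT `R′`**: «(Lⁿη)⁻¹ dist(Ω_nᶜ, Ω_{n+1}) > R′M» in the torus distance — EXACTLY the shape of ✓`TDomains.sepT` with `R′` for the member's `R`
(so `SepY i i.R` is the member's own field).  A hypothesis on the member («R sufficiently large»), NOT a fact. [cite: Balaban1984PropagatorsII, (2.2) p.224] -/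
def SepY (R' : ℕ) : Prop :=
  ∀ n, ∀ y ∈ boxDom (toKT i).NB, ∀ y' ∈ boxDom (toKT i).NB, (toKT i).D.lev y < n → n + 1 ≤ (toKT i).D.lev y' →
    ((R' * bigSide ℓ (toKT i).Mh n : ℕ) : ℝ) < torusSupNorm (toKT i).NB (y - y')

/-- the member satisfies `SepY` at its own constant `R` (its field `sepT`). [cite: Balaban1984PropagatorsII, (2.2) p.224, bookkeeping] -/
theorem sepY_self : SepY i (toKT i).R := fun n y hy y' hy' h1 h2 => (toKT i).D.sepT n y hy y' hy' h1 h2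

/-- `SepY` is antitone in the constant. [cite: Balaban1984PropagatorsII, (2.2) p.224, bookkeeping] -/
theorem sepY_mono {R' R'' : ℕ} (h : R'' ≤ R') (hs : SepY i R') : SepY i R'' := fun n y hy y' hy' h1 h2 =>
  lt_of_le_of_lt (by exact_mod_cast Nat.mul_le_mul_right _ h) (hs n y hy y' hy' h1 h2)

/-- NON-VACUITY OF THE RANGE: a member all of whose sites have ONE level (e.g. [4]'s «Ω_j = T_η for j = 1, …, k», ✓`TDomains.top`) satisfies `SepY` at EVERY constant.
[cite: Balaban1984PropagatorsII, (2.1) p.224 («we admit the case when some domains Ω_j are equal to T_η»), bookkeeping] -/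
theorem sepY_of_const_lev {n₀ : ℕ} (hlev : ∀ y ∈ boxDom (toKT i).NB, (toKT i).D.lev y = n₀) (R' : ℕ) : SepY i R' := by
  intro n y hy y' hy' h1 h2
  have := hlev y hy; have := hlev y' hy'; omega

/-- **THE DEEPNESS CONSTANT** `deepRY = (nHalfY + 2)·L = (2R + 8L + 2)·L`: (2.2) at this constant makes every datum cube of (T1) see at most two adjacent levels.
[cite: Balaban1985BackgroundPropagators, p.396 («□ ⊂ Bʲ(Λ_j) ∪ B^{j+1}(Λ_{j+1})»), p.408; Balaban1984PropagatorsII, (2.2) p.224, dictionary] -/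
def deepRY : ℕ := (nHalfY i + 2) * (ℓ + 1)

end Sep

/-! ## §2  The level clause of the datum cube under `SepY i deepRY` -/

section Levels

variable (i : KIdx d ℓ hd hL b₀ b₁) (q : ↥(cubes (toKT i).D.toDomains))

/-- a site of the datum cube is within `nHalfY·S_j + 2hf_j = (nHalfY + 1)·S_j − 1` of the level-`j` witness of `β`, in the torus distance.
[cite: Balaban1985BackgroundPropagators, p.408; Balaban1984PropagatorsII, p.229 («with a center y ∈ Λ_j»), bookkeeping] -/
theorem torusSupNorm_sub_wit_le {x : Site (PV d ℓ i.m i.K hd hL) 0} (hx : x ∈ torusCube (cornerYCut i q) ((2 * nHalfY i + 1) * bigSide ℓ (toKT i).Mh q.1.1)) :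
    torusSupNorm (toKT i).NB ((toBox i.hN x).1 - (wit (toKT i).D.toDomains q).1) ≤ ((((nHalfY i : ℤ) + 1) * sI ℓ (toKT i).Mh q.1.1 - 1 : ℤ) : ℝ) ∧
    torusSupNorm (toKT i).NB ((wit (toKT i).D.toDomains q).1 - (toBox i.hN x).1) ≤ ((((nHalfY i : ℤ) + 1) * sI ℓ (toKT i).Mh q.1.1 - 1 : ℤ) : ℝ) := by
  have hMh := (toKT i).hMh
  have hP := (toKT i).hP
  have hhf : 2 * hf ℓ (toKT i).Mh q.1.1 + 1 = sI ℓ (toKT i).Mh q.1.1 := two_mul_hf_add_one hL.1 (oddMh i) q.1.1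
  have key : ∀ μ, circAbs ((toKT i).NB μ) ((toBox i.hN x).1 μ - (wit (toKT i).D.toDomains q).1 μ) ≤ ((nHalfY i : ℤ) + 1) * sI ℓ (toKT i).Mh q.1.1 - 1 := by
    intro μ
    have hN : 1 ≤ (toKT i).NB μ := one_le_N0 hMh hP μ
    have h1 := circAbs_le_of_mem_torusCube_cornerYCut i q hx μ
    have h2 : circAbs ((toKT i).NB μ) ((toBox i.hN x).1 μ - (wit (toKT i).D.toDomains q).1 μ) ≤
        circAbs ((toKT i).NB μ) ((wit (toKT i).D.toDomains q).1 μ - ctrC q μ) + circAbs ((toKT i).NB μ) ((toBox i.hN x).1 μ - ctrC q μ) := by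
      have := circAbs_sub_le_add hN ((toBox i.hN x).1 μ) (ctrC q μ) ((wit (toKT i).D.toDomains q).1 μ)
      rw [circAbs_sub_comm hN (ctrC q μ)] at this; exact this
    have h3 : circAbs ((toKT i).NB μ) ((wit (toKT i).D.toDomains q).1 μ - ctrC q μ) ≤ hf ℓ (toKT i).Mh q.1.1 :=
      (circAbs_le_abs hN _).trans (abs_sub_ctrC_le_of_blk_eq hL.1 (oddMh i) hMh q (blk_wit (toKT i).D.toDomains q) μ)
    linarith
  constructor
  · exact torusSupNorm_le_of_forall _ _ fun μ => by rw [Pi.sub_apply]; exact_mod_cast key μ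
  · exact torusSupNorm_le_of_forall _ _ fun μ => by
      rw [Pi.sub_apply, circAbs_sub_comm (one_le_N0 hMh hP μ)]; exact_mod_cast key μ

/-- two sites of the datum cube are within `2·nHalfY·S_j + 2hf_j = (2·nHalfY + 1)·S_j − 1` of each other. [cite: Balaban1985BackgroundPropagators, (3.35) p.396 («its size … is O(1)MLʲη»), bookkeeping] -/
theorem torusSupNorm_sub_le_of_mem {x x' : Site (PV d ℓ i.m i.K hd hL) 0} (hx : x ∈ torusCube (cornerYCut i q) ((2 * nHalfY i + 1) * bigSide ℓ (toKT i).Mh q.1.1))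
    (hx' : x' ∈ torusCube (cornerYCut i q) ((2 * nHalfY i + 1) * bigSide ℓ (toKT i).Mh q.1.1)) :
    torusSupNorm (toKT i).NB ((toBox i.hN x).1 - (toBox i.hN x').1) ≤ (((2 * (nHalfY i : ℤ) + 1) * sI ℓ (toKT i).Mh q.1.1 - 1 : ℤ) : ℝ) := by
  have hMh := (toKT i).hMh
  have hP := (toKT i).hP
  have hhf : 2 * hf ℓ (toKT i).Mh q.1.1 + 1 = sI ℓ (toKT i).Mh q.1.1 := two_mul_hf_add_one hL.1 (oddMh i) q.1.1
  refine torusSupNorm_le_of_forall _ _ fun μ => ?_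
  have hN : 1 ≤ (toKT i).NB μ := one_le_N0 hMh hP μ
  have h1 := circAbs_le_of_mem_torusCube_cornerYCut i q hx μ
  have h2 := circAbs_le_of_mem_torusCube_cornerYCut i q hx' μ
  have h3 := circAbs_sub_le_add hN ((toBox i.hN x).1 μ) ((toBox i.hN x').1 μ) (ctrC q μ)
  rw [circAbs_sub_comm hN ((toBox i.hN x).1 μ) ((toBox i.hN x').1 μ)] at h3
  rw [Pi.sub_apply]
  have : circAbs ((toKT i).NB μ) ((toBox i.hN x).1 μ - (toBox i.hN x').1 μ) ≤ (2 * (nHalfY i : ℤ) + 1) * sI ℓ (toKT i).Mh q.1.1 - 1 := by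
    have h4 := circAbs_sub_le_add hN ((toBox i.hN x).1 μ) ((toBox i.hN x').1 μ) (ctrC q μ)
    -- `circAbs(x − x′) ≤ circAbs(x − c) + circAbs(x′ − c)`
    have h5 : circAbs ((toKT i).NB μ) ((toBox i.hN x).1 μ - (toBox i.hN x').1 μ) ≤
        circAbs ((toKT i).NB μ) ((toBox i.hN x').1 μ - ctrC q μ) + circAbs ((toKT i).NB μ) ((toBox i.hN x).1 μ - ctrC q μ) := by
      have := circAbs_sub_le_add hN ((toBox i.hN x).1 μ) (ctrC q μ) ((toBox i.hN x').1 μ)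
      rw [circAbs_sub_comm hN (ctrC q μ)] at this; exact this
    linarith
  exact_mod_cast this

/-- the arithmetic of deepness: `(nHalfY + 1)·S_j − 1 < deepRY·S_{j−1}` (`j ≥ 1`; `deepRY·S_{j−1} = (nHalfY+2)·S_j`), `< deepRY·S_{j+1}`, and `(2nHalfY + 1)·S_j − 1 < deepRY·S_j`.
[cite: Balaban1984PropagatorsII, (2.1)–(2.2) p.224, bookkeeping] -/
theorem deep_arith :
    ((((nHalfY i : ℤ) + 1) * sI ℓ (toKT i).Mh q.1.1 - 1 : ℤ) : ℝ) < ((deepRY i * bigSide ℓ (toKT i).Mh (q.1.1 - 1) : ℕ) : ℝ) ∧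
    ((((nHalfY i : ℤ) + 1) * sI ℓ (toKT i).Mh q.1.1 - 1 : ℤ) : ℝ) < ((deepRY i * bigSide ℓ (toKT i).Mh (q.1.1 + 1) : ℕ) : ℝ) ∧
    (((2 * (nHalfY i : ℤ) + 1) * sI ℓ (toKT i).Mh q.1.1 - 1 : ℤ) : ℝ) < ((deepRY i * bigSide ℓ (toKT i).Mh q.1.1 : ℕ) : ℝ) := by
  have hMh := (toKT i).hMh
  have hj := one_le_cube_level q
  have hS : ∀ n, (1 : ℤ) ≤ ((bigSide ℓ (toKT i).Mh n : ℕ) : ℤ) := fun n => by exact_mod_cast one_le_bigSide hMh n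
  have e1 : bigSide ℓ (toKT i).Mh q.1.1 = (ℓ + 1) * bigSide ℓ (toKT i).Mh (q.1.1 - 1) := by
    rw [← bigSide_succ]; congr 1; omega
  have e2 : bigSide ℓ (toKT i).Mh (q.1.1 + 1) = (ℓ + 1) * bigSide ℓ (toKT i).Mh q.1.1 := bigSide_succ _ _ _
  have hn0 : (0 : ℤ) ≤ (nHalfY i : ℤ) := Nat.cast_nonneg _
  have hℓ0 : (0 : ℤ) ≤ (ℓ : ℤ) := Nat.cast_nonneg _
  set S' : ℤ := ((bigSide ℓ (toKT i).Mh (q.1.1 - 1) : ℕ) : ℤ) with hS'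
  set S : ℤ := ((bigSide ℓ (toKT i).Mh q.1.1 : ℕ) : ℤ) with hSd
  have hS'1 : 1 ≤ S' := hS _
  have hS1 : 1 ≤ S := hS _
  have eS : S = ((ℓ : ℤ) + 1) * S' := by rw [hSd, e1]; push_cast; rw [hS']
  have h1 : (((nHalfY i : ℤ) + 1) * sI ℓ (toKT i).Mh q.1.1 - 1 : ℤ) < ((deepRY i * bigSide ℓ (toKT i).Mh (q.1.1 - 1) : ℕ) : ℤ) := by
    unfold deepRY sI; push_cast; rw [← hSd, ← hS', eS]
    have key : ((nHalfY i : ℤ) + 2) * ((ℓ : ℤ) + 1) * S' = ((nHalfY i : ℤ) + 1) * (((ℓ : ℤ) + 1) * S') + ((ℓ : ℤ) + 1) * S' := by ring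
    have hpos : 0 < ((ℓ : ℤ) + 1) * S' := by positivity
    linarith
  have h2 : (((nHalfY i : ℤ) + 1) * sI ℓ (toKT i).Mh q.1.1 - 1 : ℤ) < ((deepRY i * bigSide ℓ (toKT i).Mh (q.1.1 + 1) : ℕ) : ℤ) := by
    unfold deepRY sI; rw [e2]; push_cast; rw [← hSd]
    have key : ((nHalfY i : ℤ) + 2) * ((ℓ : ℤ) + 1) * (((ℓ : ℤ) + 1) * S) = ((nHalfY i : ℤ) + 1) * S + (S + ((nHalfY i : ℤ) + 2) * (((ℓ : ℤ) + 1) ^ 2 - 1) * S) := by ring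
    have hpos1 : 0 ≤ ((nHalfY i : ℤ) + 2) * (((ℓ : ℤ) + 1) ^ 2 - 1) * S := by
      have : (0 : ℤ) ≤ ((ℓ : ℤ) + 1) ^ 2 - 1 := by nlinarith
      positivity
    linarith
  have h3 : ((2 * (nHalfY i : ℤ) + 1) * sI ℓ (toKT i).Mh q.1.1 - 1 : ℤ) < ((deepRY i * bigSide ℓ (toKT i).Mh q.1.1 : ℕ) : ℤ) := by
    unfold deepRY sI; push_cast; rw [← hSd]
    have key : ((nHalfY i : ℤ) + 2) * ((ℓ : ℤ) + 1) * S = (2 * (nHalfY i : ℤ) + 1) * S + (3 * S + ((nHalfY i : ℤ) + 2) * (((ℓ : ℤ) + 1) - 2) * S) := by ring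
    have hpos : 0 ≤ ((nHalfY i : ℤ) + 2) * (((ℓ : ℤ) + 1) - 2) * S := by
      have hℓ4 : (4 : ℤ) ≤ (ℓ : ℤ) := by exact_mod_cast i.hℓ
      have : (0 : ℤ) ≤ ((ℓ : ℤ) + 1) - 2 := by linarith
      positivity
    linarith
  exact ⟨by exact_mod_cast h1, by exact_mod_cast h2, by exact_mod_cast h3⟩

/-- ★ **THE LEVEL WINDOW OF THE DATUM CUBE UNDER `SepY i deepRY`**: every V1 site of the cube has member level `j − 1`, `j` or `j + 1`.
[cite: Balaban1985BackgroundPropagators, p.396 («□ ⊂ Bʲ(Λ_j) ∪ B^{j+1}(Λ_{j+1})»), p.408; Balaban1984PropagatorsII, (2.2) p.224] -/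
theorem levV1_window_of_sepY (hsep : SepY i (deepRY i)) {x : Site (PV d ℓ i.m i.K hd hL) 0}
    (hx : x ∈ torusCube (cornerYCut i q) ((2 * nHalfY i + 1) * bigSide ℓ (toKT i).Mh q.1.1)) :
    q.1.1 - 1 ≤ levV1 i x ∧ levV1 i x ≤ q.1.1 + 1 := by
  obtain ⟨d1, d2⟩ := torusSupNorm_sub_wit_le i q hx
  obtain ⟨a1, a2, -⟩ := deep_arith i q
  have hw := lev_wit (toKT i).D.toDomains q
  have hj := one_le_cube_level q
  constructor
  · by_contra hlt
    push Not at hlt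
    -- `lev x < j − 1`, `lev w = j ≥ (j − 1) + 1`
    have hs := hsep (q.1.1 - 1) (toBox i.hN x).1 (toBox i.hN x).2 (wit (toKT i).D.toDomains q).1 (wit (toKT i).D.toDomains q).2
      (by unfold levV1 at hlt; exact hlt) (by rw [show (toKT i).D.toDomains.lev = (toKT i).D.lev from rfl] at hw; rw [hw]; omega)
    linarith
  · by_contra hlt
    push Not at hlt
    have hs := hsep (q.1.1 + 1) (wit (toKT i).D.toDomains q).1 (wit (toKT i).D.toDomains q).2 (toBox i.hN x).1 (toBox i.hN x).2
      (by rw [show (toKT i).D.toDomains.lev = (toKT i).D.lev from rfl] at hw; rw [hw]; omega) (by unfold levV1 at hlt; exact hlt)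
    linarith

/-- ★ under `SepY i deepRY` the datum cube does NOT contain both a site of level `j − 1` and a site of level `j + 1`.
[cite: Balaban1985BackgroundPropagators, p.396; Balaban1984PropagatorsII, (2.2) p.224] -/
theorem not_both_of_sepY (hsep : SepY i (deepRY i)) {x x' : Site (PV d ℓ i.m i.K hd hL) 0}
    (hx : x ∈ torusCube (cornerYCut i q) ((2 * nHalfY i + 1) * bigSide ℓ (toKT i).Mh q.1.1))
    (hx' : x' ∈ torusCube (cornerYCut i q) ((2 * nHalfY i + 1) * bigSide ℓ (toKT i).Mh q.1.1))
    (h1 : levV1 i x + 1 = q.1.1) (h2 : levV1 i x' = q.1.1 + 1) : False := by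
  have d := torusSupNorm_sub_le_of_mem i q hx hx'
  obtain ⟨-, -, a3⟩ := deep_arith i q
  have hs := hsep q.1.1 (toBox i.hN x).1 (toBox i.hN x).2 (toBox i.hN x').1 (toBox i.hN x').2
    (by have h := h1; unfold levV1 at h; change (toKT i).D.lev _ + 1 = _ at h; omega)
    (by have h := h2; unfold levV1 at h; change (toKT i).D.lev _ = _ at h; omega)
  linarith

/-- ★★ **THE INSCRIPTION UNDER `SepY i deepRY`** (LOCATED-42 (T2)): the aligned cube of (T1) is a print-class triple of index `j′ = j` (size `nD`) or `j′ = j − 1` (size `nD·L`,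
the same set): `1 ≤ j′ ≤ k`, corner on the big-`j′`-block grid, every site of level `j′` or `j′ + 1`, one site of level `j′`.
[cite: Balaban1985BackgroundPropagators, p.396 (the cube class), Cor. 3.6 p.408 l.1–14 («the cube □⁵ is contained in one of the cubes for which this condition holds»); Balaban1984PropagatorsII, (2.2) p.224] -/
theorem exists_inscription_of_sepY (hsep : SepY i (deepRY i)) :
    ∃ j' n' : ℕ, (j' = q.1.1 ∨ j' + 1 = q.1.1) ∧ 1 ≤ j' ∧ j' ≤ i.k ∧ 2 * nHalfY i + 1 ≤ n' ∧ n' ≤ (2 * nHalfY i + 1) * (ℓ + 1) ∧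
      (∀ μ, bigSide ℓ i.Mh j' ∣ (cornerYCut i q μ).val) ∧
      n' * bigSide ℓ i.Mh j' = (2 * nHalfY i + 1) * bigSide ℓ (toKT i).Mh q.1.1 ∧
      (∀ x ∈ torusCube (cornerYCut i q) (n' * bigSide ℓ i.Mh j'), levV1 i x = j' ∨ levV1 i x = j' + 1) ∧
      ∃ x ∈ torusCube (cornerYCut i q) (n' * bigSide ℓ i.Mh j'), levV1 i x = j' := by
  have hj := one_le_cube_level q
  have hjk : q.1.1 ≤ i.k := cube_level_le q
  have hw := wit_mem_torusCube i q
  have hlw := levV1_wit i q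
  by_cases hlow : ∃ x ∈ torusCube (cornerYCut i q) ((2 * nHalfY i + 1) * bigSide ℓ (toKT i).Mh q.1.1), levV1 i x + 1 = q.1.1
  · -- index `j − 1`, size `nD·L`
    obtain ⟨x₀, hx₀, hl₀⟩ := hlow
    have hj2 : 2 ≤ q.1.1 := by have := B9BackgroundsKLevelV1.levV1_pos i x₀; omega
    have e : (2 * nHalfY i + 1) * (ℓ + 1) * bigSide ℓ i.Mh (q.1.1 - 1) = (2 * nHalfY i + 1) * bigSide ℓ (toKT i).Mh q.1.1 := by
      show (2 * nHalfY i + 1) * (ℓ + 1) * bigSide ℓ i.Mh (q.1.1 - 1) = (2 * nHalfY i + 1) * bigSide ℓ i.Mh q.1.1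
      rw [show q.1.1 = q.1.1 - 1 + 1 from by omega, bigSide_succ, Nat.add_sub_cancel]; ring
    refine ⟨q.1.1 - 1, (2 * nHalfY i + 1) * (ℓ + 1), Or.inr (by omega), by omega, by omega, Nat.le_mul_of_pos_right _ (Nat.succ_pos ℓ), le_rfl,
      fun μ => (Dvd.intro_left _ (by rw [show q.1.1 = q.1.1 - 1 + 1 from by omega, bigSide_succ, Nat.add_sub_cancel]) :
        bigSide ℓ i.Mh (q.1.1 - 1) ∣ bigSide ℓ i.Mh q.1.1).trans (bigSide_dvd_cornerYCut_val i q μ), e, ?_, ⟨x₀, by rw [e]; exact hx₀, by omega⟩⟩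
    intro x hx
    rw [e] at hx
    obtain ⟨g1, g2⟩ := levV1_window_of_sepY i q hsep hx
    rcases Nat.lt_or_ge (levV1 i x) (q.1.1 + 1) with h | h
    · omega
    · exact (not_both_of_sepY i q hsep hx₀ hx hl₀ (by omega)).elim
  · -- index `j`, size `nD`
    push Not at hlow
    refine ⟨q.1.1, 2 * nHalfY i + 1, Or.inl rfl, hj, hjk, le_rfl, Nat.le_mul_of_pos_right _ (Nat.succ_pos ℓ), bigSide_dvd_cornerYCut_val i q, rfl, ?_,
      ⟨_, hw, hlw⟩⟩
    intro x hx
    obtain ⟨g1, g2⟩ := levV1_window_of_sepY i q hsep hx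
    have := hlow x hx
    omega

end Levels

/-! ## §3  ★★★ D3 = D1 ∘ (T1) ∘ (T2): the (3.35) bond datum of `Ω₀(□)` from the heads' regime ON THE RANGE `SepY` (+ all directions mirrored) -/

section Datum

variable {Mstar : ℕ} {G : Subgroup (Matrix (Fin N) (Fin N) ℂ)ˣ}

/-- **THE DATUM SIZE** `nDatY = (4R + 16L + 1)·L` (big `j′`-blocks, `j′ = j − 1` worst case) entering the per-cube (3.35) constant `nDatY·M·α₀`.
[cite: Balaban1985BackgroundPropagators, (3.35) p.396 («O(1)M … a size of □»), Cor. 3.6 p.408 («the number O(1) in the condition (3.35) can be taken as equal to 12»), dictionary] -/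
def nDatY (i : KIdx d ℓ hd hL b₀ b₁) : ℕ := (2 * nHalfY i + 1) * (ℓ + 1)

/-- the knit-leg numerics are monotone in the datum constant (used to read them at the worst case `nDatY`). [cite: Balaban1985BackgroundPropagators, (3.35) p.396, bookkeeping] -/
theorem numerics_mono {X X' a₁ ϱ' α₀' c₃ : ℝ} {d' : ℕ} (hXX : X' ≤ X)
    (hs₁ : X ≤ a₁) (hs₂ : 3 * X ≤ ϱ')
    (hs₃ : Real.exp (4 * (800 * (((d' + 1 : ℕ) : ℝ) + 1) ^ 2 * (((d' + 1 : ℕ) : ℝ) + 4)) * α₀') * (1 + 8 * (131072 * (((d' + 1 : ℕ) : ℝ) + 1) ^ 2) * X) ≤ 2)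
    (hs₄ : 2 * X ≤ c₃) (hs₅ : 4096 * ((d' + 1 : ℕ) : ℝ) * X ≤ 1) :
    X' ≤ a₁ ∧ 3 * X' ≤ ϱ' ∧
    Real.exp (4 * (800 * (((d' + 1 : ℕ) : ℝ) + 1) ^ 2 * (((d' + 1 : ℕ) : ℝ) + 4)) * α₀') * (1 + 8 * (131072 * (((d' + 1 : ℕ) : ℝ) + 1) ^ 2) * X') ≤ 2 ∧
    2 * X' ≤ c₃ ∧ 4096 * ((d' + 1 : ℕ) : ℝ) * X' ≤ 1 := by
  have hE : 0 < Real.exp (4 * (800 * (((d' + 1 : ℕ) : ℝ) + 1) ^ 2 * (((d' + 1 : ℕ) : ℝ) + 4)) * α₀') := Real.exp_pos _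
  have hK : 0 ≤ 8 * (131072 * (((d' + 1 : ℕ) : ℝ) + 1) ^ 2) := by positivity
  have hd : 0 ≤ ((d' + 1 : ℕ) : ℝ) := Nat.cast_nonneg _
  refine ⟨hXX.trans hs₁, by linarith, le_trans (mul_le_mul_of_nonneg_left (by nlinarith) hE.le) hs₃, by linarith, by nlinarith⟩

/-- ★★★ **THE (3.35) BOND DATUM OF `Ω₀(□)` FROM THE HEADS' REGIME, THE INSCRIPTION DISCHARGED ON THE RANGE `SepY`** (LOCATED-42 (T3) = ✓D1 `datumBUY_of_regYP335` ∘ (T1)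
`bondCutSetY_subset_torusCube` ∘ (T2) `exists_inscription_of_sepY`): at a member `x` whose territories are (2.2)-separated at the constant `deepRY = (2R + 8L + 2)·L`, for a
cover cube `□` all of whose directions are mirrored (the heads' `hMirA`), a configuration `U` in the print-class regime `regYP335 … x c_P α₀` with `c_P ≤ 4R + 16L + 1` carries
`DatumBUY x.toKIdx □ U a₁ α₀′ ϱ′` as soon as the knit numerics hold at the constant `2·(nDatY·M·α₀)·L⁴` (`nDatY = (4R+16L+1)·L`, `Λ = L²`).  This discharges the heads' `hDatBu`
ON THE RANGE `SepY x.toKIdx (deepRY x.toKIdx)`; at shallow cubes outside that range the row is unsatisfiable as typed (LOCATED-42 §1).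
[cite: Balaban1985BackgroundPropagators, (3.35) p.396, Cor. 3.6 p.408 l.1–14 («Ω₀(□) ⊂ □⁵ … contained in one of the cubes for which this condition holds»), p.409 l.1–5; Balaban1984PropagatorsII, (2.2) p.224] -/
theorem datumBUY_of_regYP335_of_sepY (x : MemberY d ℓ hd hL b₀ b₁ Mstar) {cP α₀ : ℝ} {a₁ α₀' ϱ' : ℝ}
    (U : CfgY (Matrix (Fin N) (Fin N) ℂ) x.toKIdx) (h : regYP335 (Matrix (Fin N) (Fin N) ℂ) G x cP α₀ U) (c : ↥(cubes (toKT x.toKIdx).D.toDomains))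
    (hmir : ∀ μ, mirC c μ = true) (hsep : SepY x.toKIdx (deepRY x.toKIdx)) (hcn : cP ≤ ((2 * nHalfY x.toKIdx + 1 : ℕ) : ℝ)) (hα₀ : 0 ≤ α₀)
    (hs₁ : 2 * ((nDatY x.toKIdx : ℝ) * ((kGeo x.toKIdx).M * α₀)) * (((ℓ : ℝ) + 1) ^ 2) ^ 2 ≤ a₁)
    (hs₂ : 3 * (2 * ((nDatY x.toKIdx : ℝ) * ((kGeo x.toKIdx).M * α₀)) * (((ℓ : ℝ) + 1) ^ 2) ^ 2) ≤ ϱ')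
    (hs₃ : Real.exp (4 * (800 * (((d + 1 : ℕ) : ℝ) + 1) ^ 2 * (((d + 1 : ℕ) : ℝ) + 4)) * α₀') *
      (1 + 8 * (131072 * (((d + 1 : ℕ) : ℝ) + 1) ^ 2) * (2 * ((nDatY x.toKIdx : ℝ) * ((kGeo x.toKIdx).M * α₀)) * (((ℓ : ℝ) + 1) ^ 2) ^ 2)) ≤ 2)
    (hs₄ : 2 * (2 * ((nDatY x.toKIdx : ℝ) * ((kGeo x.toKIdx).M * α₀)) * (((ℓ : ℝ) + 1) ^ 2) ^ 2) ≤ B7Prop3Flat.c3 (d + 1) (ℓ + 1))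
    (hs₅ : 4096 * ((d + 1 : ℕ) : ℝ) * (2 * ((nDatY x.toKIdx : ℝ) * ((kGeo x.toKIdx).M * α₀)) * (((ℓ : ℝ) + 1) ^ 2) ^ 2) ≤ 1) :
    DatumBUY x.toKIdx c U a₁ α₀' ϱ' := by
  obtain ⟨j', n', hj', hj1, hjk, hn1, hn2, hc₀, hset, hlev, hmeet⟩ := exists_inscription_of_sepY x.toKIdx c hsep
  have hL1 : (1 : ℝ) ≤ (ℓ : ℝ) + 1 := by linarith [(Nat.cast_nonneg ℓ : (0 : ℝ) ≤ ℓ)]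
  have hΛ : (1 : ℝ) ≤ ((ℓ : ℝ) + 1) ^ 2 := one_le_pow₀ hL1
  have hη : 0 < (kGeo x.toKIdx).eta := by rw [← B9CubeGeometryInputs.geoCK_eta x.toKIdx c]; exact B9CubeGeometryInputs.geoCK_eta_pos x.toKIdx c
  -- the scale row `L^{j+1}η ≤ L²·L^{j′}η` (`j′ ≥ j − 1`)
  have hΛξ : LatticeNorms.scaleLen ((ℓ : ℝ) + 1) (kGeo x.toKIdx).eta (c.1.1 + 1) ≤ ((ℓ : ℝ) + 1) ^ 2 * LatticeNorms.scaleLen ((ℓ : ℝ) + 1) (kGeo x.toKIdx).eta j' := by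
    unfold LatticeNorms.scaleLen
    rw [← mul_assoc, ← pow_add]
    refine mul_le_mul_of_nonneg_right (pow_le_pow_right₀ hL1 (by omega)) hη.le
  -- the size rows at `n′ ≤ nDatY`
  have hn' : (1 : ℕ) ≤ n' := le_trans (Nat.succ_le_succ (Nat.zero_le _)) hn1
  have hcn' : cP ≤ (n' : ℝ) := hcn.trans (by exact_mod_cast hn1)
  have hM : 0 ≤ (kGeo x.toKIdx).M := by rw [show (kGeo x.toKIdx).M = ((ℓ + 1 : ℕ) : ℝ) * (x.toKIdx.Mh : ℝ) from rfl]; positivity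
  have hXX : 2 * ((n' : ℝ) * ((kGeo x.toKIdx).M * α₀)) * (((ℓ : ℝ) + 1) ^ 2) ^ 2 ≤ 2 * ((nDatY x.toKIdx : ℝ) * ((kGeo x.toKIdx).M * α₀)) * (((ℓ : ℝ) + 1) ^ 2) ^ 2 := by
    have : (n' : ℝ) ≤ (nDatY x.toKIdx : ℝ) := by unfold nDatY; exact_mod_cast hn2
    have hMa : 0 ≤ (kGeo x.toKIdx).M * α₀ := mul_nonneg hM hα₀
    have hL4 : 0 ≤ (((ℓ : ℝ) + 1) ^ 2) ^ 2 := by positivity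
    nlinarith [mul_nonneg hMa hL4]
  obtain ⟨t₁, t₂, t₃, t₄, t₅⟩ := numerics_mono hXX hs₁ hs₂ hs₃ hs₄ hs₅
  -- the box clause from (T1)
  have hbox : ∀ z ∈ bondCutSetY x.toKIdx c, (boxEquiv x.toKIdx.hN).symm z ∈ torusCube (cornerYCut x.toKIdx c) (n' * bigSide ℓ x.toKIdx.Mh j') := by
    intro z hz; rw [hset]; exact bondCutSetY_subset_torusCube x.toKIdx c hmir z hz
  exact datumBUY_of_reg335BodyP x.toKIdx c U h.1 (cornerYCut x.toKIdx c) hj1 hjk hn' hcn' hc₀ hlev hmeet hbox hα₀ hΛ hΛξ t₁ t₂ t₃ t₄ t₅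

end Datum

/-! ## §4  The SITE twin: dag-n06-d's `Datum36UY` (the heads' `hDat36u`) from the regime on the same range -/

section SiteDatum

variable {Mstar : ℕ} {G : Subgroup (Matrix (Fin N) (Fin N) ℂ)ˣ}

/-- ★ **`Datum36UY` FROM ONE (3.35) CUBE DATUM** (the site twin of ✓D1 `datumBUY_of_reg335Cube`): `Reg335Cube (shiftsV1 _) U η □̃ ξ C` on `□̃ ⊇ chart⁻¹(bondCutSetY i □) ⊇ chart⁻¹Ω₀(□)`,
the scale rows, `2CΛ² ≤ min(a₁, ¼)` and the window numerics at a chosen `α₀′` ⟹ `Datum36UY i □ U a₁` (gauge made unitary by ✓`unitExtY`).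
[cite: Balaban1985BackgroundPropagators, (3.35) p.396, Cor. 3.6 p.408 l.1–14, (3.28) p.395, p.409 l.1–5] -/
theorem datum36UY_of_reg335Cube (i : KIdx d ℓ hd hL b₀ b₁) (c : ↥(cubes (toKT i).D.toDomains)) (U : CfgY (Matrix (Fin N) (Fin N) ℂ) i)
    {cube : Set (Site (PV d ℓ i.m i.K hd hL) 0)} {ξ C Λ a₁ α₀' : ℝ}
    (h335 : Reg335Cube (shiftsV1 (PV d ℓ i.m i.K hd hL)) U (kGeo i).eta cube ξ C)
    (hC : 0 ≤ C) (hξ : (kGeo i).eta ≤ ξ) (hΛ : 1 ≤ Λ) (hΛξ : LatticeNorms.scaleLen ((ℓ : ℝ) + 1) (kGeo i).eta (c.1.1 + 1) ≤ Λ * ξ)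
    (hbox : ∀ z ∈ bondCutSetY i c, (boxEquiv i.hN).symm z ∈ cube)
    (hs₁ : 2 * C * Λ ^ 2 ≤ a₁) (hs₁' : 2 * C * Λ ^ 2 ≤ 1 / 4) (hα' : 0 < α₀') (hα3 : C0 (d + 1) * α₀' ≤ 1 / 3) (hα4 : 4 * α₀' ≤ c2' (d + 1) (ℓ + 1))
    (hs₃ : Real.exp (4 * (800 * (((d + 1 : ℕ) : ℝ) + 1) ^ 2 * (((d + 1 : ℕ) : ℝ) + 4)) * α₀') * (1 + 8 * (131072 * (((d + 1 : ℕ) : ℝ) + 1) ^ 2) * (2 * C * Λ ^ 2)) ≤ 2)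
    (hs₄ : 2 * (2 * C * Λ ^ 2) ≤ c3 (d + 1) (ℓ + 1)) (hs₅ : 4096 * ((d + 1 : ℕ) : ℝ) * (2 * C * Λ ^ 2) ≤ 1) :
    Datum36UY i c U a₁ := by
  obtain ⟨u, A, hu, hg, hA, hdA⟩ := h335
  refine ⟨unitExtY i cube u, A, cube, C, ξ, Λ, α₀', unitExtY_mem_unitaryUnits i hu, hC, hξ, hΛ, hΛξ,
    fun z hz => hbox z (dirDomY_subset_bondCutSetY i c hz), ?_, fun κ x hx => (hA κ x hx).le, fun μ ν x hx => (hdA μ ν x hx).le,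
    hs₁, hs₁', hα', hα3, hα4, hs₃, hs₄, hs₅⟩
  intro κ x hx hx'
  rw [gaugeY_unitExtY_eq i u U κ hx hx', gaugeY_eq_gaugeTr]
  exact hg κ x hx

/-- ★ **`Datum36UY` FROM THE REGIME, GIVEN THE INSCRIPTION** (the site twin of ✓D1 `datumBUY_of_reg335BodyP`). [cite: Balaban1985BackgroundPropagators, (3.35) p.396, p.396 (the cube class), Cor. 3.6 p.408 l.1–14] -/
theorem datum36UY_of_reg335BodyP (i : KIdx d ℓ hd hL b₀ b₁) (c : ↥(cubes (toKT i).D.toDomains)) (U : CfgY (Matrix (Fin N) (Fin N) ℂ) i)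
    {cP α₀ a₁ α₀' : ℝ} (h : (bg9KP (Matrix (Fin N) (Fin N) ℂ) G i).Reg335 cP α₀ U)
    {j' n : ℕ} (c₀ : Site (PV d ℓ i.m i.K hd hL) 0) (hj1 : 1 ≤ j') (hjk : j' ≤ i.k) (hn : 1 ≤ n) (hcn : cP ≤ (n : ℝ))
    (hc₀ : ∀ μ, bigSide ℓ i.Mh j' ∣ (c₀ μ).val)
    (hlev : ∀ x ∈ torusCube c₀ (n * bigSide ℓ i.Mh j'), levV1 i x = j' ∨ levV1 i x = j' + 1)
    (hmeet : ∃ x ∈ torusCube c₀ (n * bigSide ℓ i.Mh j'), levV1 i x = j')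
    (hbox : ∀ z ∈ bondCutSetY i c, (boxEquiv i.hN).symm z ∈ torusCube c₀ (n * bigSide ℓ i.Mh j'))
    (hα₀ : 0 ≤ α₀) {Λ : ℝ} (hΛ : 1 ≤ Λ)
    (hΛξ : LatticeNorms.scaleLen ((ℓ : ℝ) + 1) (kGeo i).eta (c.1.1 + 1) ≤ Λ * LatticeNorms.scaleLen ((ℓ : ℝ) + 1) (kGeo i).eta j')
    (hs₁ : 2 * ((n : ℝ) * ((kGeo i).M * α₀)) * Λ ^ 2 ≤ a₁) (hs₁' : 2 * ((n : ℝ) * ((kGeo i).M * α₀)) * Λ ^ 2 ≤ 1 / 4)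
    (hα' : 0 < α₀') (hα3 : C0 (d + 1) * α₀' ≤ 1 / 3) (hα4 : 4 * α₀' ≤ c2' (d + 1) (ℓ + 1))
    (hs₃ : Real.exp (4 * (800 * (((d + 1 : ℕ) : ℝ) + 1) ^ 2 * (((d + 1 : ℕ) : ℝ) + 4)) * α₀') *
      (1 + 8 * (131072 * (((d + 1 : ℕ) : ℝ) + 1) ^ 2) * (2 * ((n : ℝ) * ((kGeo i).M * α₀)) * Λ ^ 2)) ≤ 2)
    (hs₄ : 2 * (2 * ((n : ℝ) * ((kGeo i).M * α₀)) * Λ ^ 2) ≤ c3 (d + 1) (ℓ + 1)) (hs₅ : 4096 * ((d + 1 : ℕ) : ℝ) * (2 * ((n : ℝ) * ((kGeo i).M * α₀)) * Λ ^ 2) ≤ 1) :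
    Datum36UY i c U a₁ := by
  have hq := alignedCube_mem_cubeClassP i hj1 hjk hn hcn c₀ hc₀ hlev hmeet
  have h335 := reg335CubeP_of_reg335P i h hq
  rw [kGeo_L_eq] at h335
  have hη : 0 < (kGeo i).eta := by rw [← B9CubeGeometryInputs.geoCK_eta i c]; exact B9CubeGeometryInputs.geoCK_eta_pos i c
  have hL1 : (1 : ℝ) ≤ (ℓ : ℝ) + 1 := by linarith [(Nat.cast_nonneg ℓ : (0 : ℝ) ≤ ℓ)]
  have hM : 0 ≤ (kGeo i).M := by
    rw [show (kGeo i).M = ((ℓ + 1 : ℕ) : ℝ) * (i.Mh : ℝ) from rfl]; positivity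
  have hC : 0 ≤ (n : ℝ) * ((kGeo i).M * α₀) := by positivity
  have hξ : (kGeo i).eta ≤ LatticeNorms.scaleLen ((ℓ : ℝ) + 1) (kGeo i).eta j' := by
    unfold LatticeNorms.scaleLen
    calc (kGeo i).eta = 1 * (kGeo i).eta := (one_mul _).symm
      _ ≤ ((ℓ : ℝ) + 1) ^ j' * (kGeo i).eta := mul_le_mul_of_nonneg_right (one_le_pow₀ hL1) hη.le
  exact datum36UY_of_reg335Cube i c U h335 hC hξ hΛ hΛξ hbox hs₁ hs₁' hα' hα3 hα4 hs₃ hs₄ hs₅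

/-- ★★★ **`Datum36UY` (the heads' `hDat36u`) FROM THE REGIME ON THE RANGE `SepY`** — the site twin of `datumBUY_of_regYP335_of_sepY`: numerics at `2·(nDatY·M·α₀)·L⁴`, a window
`α₀′` of the caller's choosing. [cite: Balaban1985BackgroundPropagators, (3.35) p.396, Cor. 3.6 p.408 l.1–14, p.409 l.1–5; Balaban1984PropagatorsII, (2.2) p.224] -/
theorem datum36UY_of_regYP335_of_sepY (x : MemberY d ℓ hd hL b₀ b₁ Mstar) {cP α₀ a₁ α₀' : ℝ}
    (U : CfgY (Matrix (Fin N) (Fin N) ℂ) x.toKIdx) (h : regYP335 (Matrix (Fin N) (Fin N) ℂ) G x cP α₀ U) (c : ↥(cubes (toKT x.toKIdx).D.toDomains))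
    (hmir : ∀ μ, mirC c μ = true) (hsep : SepY x.toKIdx (deepRY x.toKIdx)) (hcn : cP ≤ ((2 * nHalfY x.toKIdx + 1 : ℕ) : ℝ)) (hα₀ : 0 ≤ α₀)
    (hs₁ : 2 * ((nDatY x.toKIdx : ℝ) * ((kGeo x.toKIdx).M * α₀)) * (((ℓ : ℝ) + 1) ^ 2) ^ 2 ≤ a₁)
    (hs₁' : 2 * ((nDatY x.toKIdx : ℝ) * ((kGeo x.toKIdx).M * α₀)) * (((ℓ : ℝ) + 1) ^ 2) ^ 2 ≤ 1 / 4)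
    (hα' : 0 < α₀') (hα3 : C0 (d + 1) * α₀' ≤ 1 / 3) (hα4 : 4 * α₀' ≤ c2' (d + 1) (ℓ + 1))
    (hs₃ : Real.exp (4 * (800 * (((d + 1 : ℕ) : ℝ) + 1) ^ 2 * (((d + 1 : ℕ) : ℝ) + 4)) * α₀') *
      (1 + 8 * (131072 * (((d + 1 : ℕ) : ℝ) + 1) ^ 2) * (2 * ((nDatY x.toKIdx : ℝ) * ((kGeo x.toKIdx).M * α₀)) * (((ℓ : ℝ) + 1) ^ 2) ^ 2)) ≤ 2)
    (hs₄ : 2 * (2 * ((nDatY x.toKIdx : ℝ) * ((kGeo x.toKIdx).M * α₀)) * (((ℓ : ℝ) + 1) ^ 2) ^ 2) ≤ c3 (d + 1) (ℓ + 1))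
    (hs₅ : 4096 * ((d + 1 : ℕ) : ℝ) * (2 * ((nDatY x.toKIdx : ℝ) * ((kGeo x.toKIdx).M * α₀)) * (((ℓ : ℝ) + 1) ^ 2) ^ 2) ≤ 1) :
    Datum36UY x.toKIdx c U a₁ := by
  obtain ⟨j', n', hj', hj1, hjk, hn1, hn2, hc₀, hset, hlev, hmeet⟩ := exists_inscription_of_sepY x.toKIdx c hsep
  have hL1 : (1 : ℝ) ≤ (ℓ : ℝ) + 1 := by linarith [(Nat.cast_nonneg ℓ : (0 : ℝ) ≤ ℓ)]
  have hΛ : (1 : ℝ) ≤ ((ℓ : ℝ) + 1) ^ 2 := one_le_pow₀ hL1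
  have hη : 0 < (kGeo x.toKIdx).eta := by rw [← B9CubeGeometryInputs.geoCK_eta x.toKIdx c]; exact B9CubeGeometryInputs.geoCK_eta_pos x.toKIdx c
  have hΛξ : LatticeNorms.scaleLen ((ℓ : ℝ) + 1) (kGeo x.toKIdx).eta (c.1.1 + 1) ≤ ((ℓ : ℝ) + 1) ^ 2 * LatticeNorms.scaleLen ((ℓ : ℝ) + 1) (kGeo x.toKIdx).eta j' := by
    unfold LatticeNorms.scaleLen
    rw [← mul_assoc, ← pow_add]
    refine mul_le_mul_of_nonneg_right (pow_le_pow_right₀ hL1 (by omega)) hη.le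
  have hn' : (1 : ℕ) ≤ n' := le_trans (Nat.succ_le_succ (Nat.zero_le _)) hn1
  have hcn' : cP ≤ (n' : ℝ) := hcn.trans (by exact_mod_cast hn1)
  have hM : 0 ≤ (kGeo x.toKIdx).M := by rw [show (kGeo x.toKIdx).M = ((ℓ + 1 : ℕ) : ℝ) * (x.toKIdx.Mh : ℝ) from rfl]; positivity
  have hXX : 2 * ((n' : ℝ) * ((kGeo x.toKIdx).M * α₀)) * (((ℓ : ℝ) + 1) ^ 2) ^ 2 ≤ 2 * ((nDatY x.toKIdx : ℝ) * ((kGeo x.toKIdx).M * α₀)) * (((ℓ : ℝ) + 1) ^ 2) ^ 2 := by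
    have : (n' : ℝ) ≤ (nDatY x.toKIdx : ℝ) := by unfold nDatY; exact_mod_cast hn2
    have hMa : 0 ≤ (kGeo x.toKIdx).M * α₀ := mul_nonneg hM hα₀
    have hL4 : 0 ≤ (((ℓ : ℝ) + 1) ^ 2) ^ 2 := by positivity
    nlinarith [mul_nonneg hMa hL4]
  obtain ⟨t₁, -, t₃, t₄, t₅⟩ := numerics_mono hXX hs₁ (by linarith : 3 * (2 * ((nDatY x.toKIdx : ℝ) * ((kGeo x.toKIdx).M * α₀)) * (((ℓ : ℝ) + 1) ^ 2) ^ 2) ≤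
    3 * (2 * ((nDatY x.toKIdx : ℝ) * ((kGeo x.toKIdx).M * α₀)) * (((ℓ : ℝ) + 1) ^ 2) ^ 2)) hs₃ hs₄ hs₅
  have hbox : ∀ z ∈ bondCutSetY x.toKIdx c, (boxEquiv x.toKIdx.hN).symm z ∈ torusCube (cornerYCut x.toKIdx c) (n' * bigSide ℓ x.toKIdx.Mh j') := by
    intro z hz; rw [hset]; exact bondCutSetY_subset_torusCube x.toKIdx c hmir z hz
  exact datum36UY_of_reg335BodyP x.toKIdx c U h.1 (cornerYCut x.toKIdx c) hj1 hjk hn' hcn' hc₀ hlev hmeet hbox hα₀ hΛ hΛξ t₁ (hXX.trans hs₁') hα' hα3 hα4 t₃ t₄ t₅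

end SiteDatum

end Literature.MathematicalPhysics.QuantumFieldTheory.Balaban1983to89.B9Cor36GDirBondDatumInscribed

end
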